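import Summits.QuantumFields.BalabanUV.Beta.D1BFx.SbpShellRemainder

/-!
# `BalabanUV.Beta.D1BFx.SbpScalarEnd` — road «BF-x» for binder row D1 (PART 4 OF 4, THE END): **THE SCALAR WALL BY SUMMATION BY PARTS — NO SECOND-DIFFERENCE
# ROW AT ALL** (the shell rows `h2s` ∕ `d2s` of `ShellRoadEnd.d1Drift_of_strongRoad_shell` are NOT NEEDED: the mixed second difference of the
# correction `E = G − gFree` enters the (1.22) integrand LINEARLY, and one Abel summation in the `ν`-direction over `ℤ⁴` moves it onto the
# weight `w_μ w_ν · Q_G(w)`, leaving only FIRST differences — rows `h0` ∕ `h1` ∕ `d0` ∕ `d1`, all of which are already theorems for the road's leg)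

HONEST DEPENDENCY (page 1, mandatory): continuum YM on T⁴ ⇐ BetaPertH ∧ nine spine estimates (0/9 proved); BetaPertH ⇐ (D1) ∧ (D4) ∧ CAP+tail;
G-an2-4 gates asym, D1 and NE2/3/4.  HONEST FRAMING (cell contract, verbatim): «discharging `BetaPertH` makes Bałaban's UV stability UNCONDITIONAL —
a real constructive-QFT result; it is NOT the continuum limit and NOT the Clay problem.»  THIS MODULE DISCHARGES NOTHING of the wall by itself:
it is [folklore] analysis about an ARBITRARY function `G : ℤ⁴ → ℝ` obeying four displayed rows, composed BY NAME with the tree's window machinery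
(`ShellWindowInterface.oneLoopDrift_of_windowSumPow_identity`, `WindowInterface.tail_sum_le_exp`, `WindowIdentification.fullSum_*`, `SquareTable.stK_eq_closedForm`
∕ `mixedDiffFun_sq` ∕ `stencilSum_bf_free`, the UNCONDITIONAL free legs `TwoPowerLegs.free.baseLeg` ∕ `free.fwdLeg` ∕ `freeMixedLeg`).  No `def`, no `Prop`
mirror, no cited fact, 0 sorry.  0 wall binders instantiated; NOT D1, NOT `BetaPertH`, NOT continuum, NOT Clay.

ABSOLUTE RULE (cell charter, verbatim): «No internally-minted statement may enter as a cited fact. Every hypothesis is either kernel-proved in this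
package or a verbatim quotation of a PUBLISHED theorem with page reference. The manuscript(s) under audit are NOT citable for their own disputed steps —
they are the thing under adjudication; programme-internal (2001/route/tribunal) claims are never citable.»

WHY (owner gen 13; `CENSUS-K6a-v1.md` §v4.21 «legs h2s∕d2s OPEN, ROUTE P, an5 class»; `LEAVES-BFx.md` INTEGRATION #35).  Every END of road BF-x displays the
two SHELL rows of the frozen profile `gfrz n a b`: `h2s` (window shells: `Σ_{‖v‖∞=r+1}|D_{μν}(gfrz − gFree)(v)| ≤ D₂/n`) and `d2s` (exterior shells), inherited
from leaf-07's shell wall `ShellGradedRoad` ∕ `ShellRoadEnd` (C3-SHELL).  They are TRUE for the road's leg but not derivable from the tree: the tree holds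
only CROSS mixed second differences of `K^∞` (`VectorLegVolumeAdapter.gamma_row2x`, `VectorTailsPt.legs_pt_A`), and the pure observation-side second
difference of the Woodbury kernel has a `log` layer at block edges (gen-3 finding).  THE POINT OF THIS FILE: the wall never needed them.  With
`stK μ ν N G w = w_μ w_ν·[D_{μν}G(w)·Q_G(w) + P_G(w)]` (`SquareTable.stK_eq_closedForm` + `mixedDiffFun_sq`; `Q_G(w) = 8N²(G(w+e_ν+e_μ) + G(w+e_ν)) −
4N²G(w)`, `P_G` = products of FIRST differences) and `D_{μν}G = D_{μν}gFree + D_{μν}E`, the only second difference of the correction is the term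
`A(w) := w_μw_ν Q_G(w)·D_{μν}E(w)`, and `D_{μν}E(w) = ψ(w+e_ν) − ψ(w)` with `ψ := F_μ E`.  Summed over ALL of `ℤ⁴` (it is absolutely summable: `Q_G`
decays at scale `n`), `Σ_w φ(w)(ψ(w+e_ν) − ψ(w)) = −Σ_w (φ(w) − φ(w−e_ν))·ψ(w)` with `φ := w_μw_νQ_G` — NO boundary terms — and the right side is a
product of FIRST-ORDER quantities: `|ψ| ≤ D₁/n³` on all of `ℤ⁴` (row `h1`), `|φ(w) − φ(w−e_ν)| ≲ 1/‖w‖ + ‖w‖D₀/n² + ‖w‖²D₁/n³` on the window and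
`≲ e^{−(δ/n)‖w‖}/‖w‖` beyond it (rows `h0`/`h1`/`d0`/`d1` + the free legs), whence `|Σ A| = O(1)` uniformly in `n`.  Every other term of
`fullSum (stK G) − Σ_{0<‖w‖∞≤n} stK gFree` is pointwise-small (`h0`/`h1` on the window, `d0`/`d1` + the free mixed leg beyond it).
RESULT: `sbp_A1` — the A₁-form `|fullSum (stK μ ν N G) − Σ_{0<‖w‖∞≤n} stK μ ν N gFree w| ≤ A₁(N, D₀, D₁, A₀, A₁, δ)` from `h0`/`h1`/`d0`/`d1` ONLY —
and the C3 END `d1Drift_of_strongRoad_sbp` = `ShellRoadEnd.d1Drift_of_strongRoad_shell` WITH `h2s` AND `d2s` DELETED (same other binders, verbatim).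
For the road's leg `gfrz` the four remaining rows are THEOREMS (`FrozenLegProfile.abs_gfrz_sub_gFree_le` ∕ `abs_gfrz_diff_flat_le` unconditional;
`FrozenLegTails.gfrz_rows_d0_d1_of_prop12` modulo [B5 Prop 1.2] ∕ [(1.126)–(1.127)] BY NAME), so after the mechanical twins of the chain above
`RoadEndBFxTotalShellS` the END-ii END displays NO leg row (ROUTE P closed at the scalar-wall level; the twins are swarm work, statement-first).

CONTENT (PARTS 1–3 = `SbpShellAlgebra` (algebra, pointwise sizes, plumbing), `SbpShellTerm` (the Abel-summed term), `SbpShellRemainder` (the remainder, `sbp_A1`)).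
* [folklore] `stK_free_eq_lattBubble` (the free reference integrand IS the realised table's window kernel), `gFree_facts` (the four UNCONDITIONAL free-leg facts
  from `TwoPowerLegs.free.baseLeg` ∕ `free.fwdLeg` ∕ `freeMixedLeg`), and the C3 END **`d1Drift_of_strongRoad_sbp`** (binders = `d1Drift_of_strongRoad_shell`'s minus
  `h2s`/`d2s`, character for character otherwise).
Unit `b2b-balaban-beta-d1-p2` (gen 13), road «BF-x» OWNER; `LEAVES-BFx.md` row «C3-SBP»; CENSUS-K6a §v4.22.
-/

noncomputable section

open Finset Filter Topology
open scoped BigOperators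
open Literature.Probability.LatticeModels (annulus box)
open Literature.MathematicalPhysics.QuantumFieldTheory.Balaban1983to89
open Literature.MathematicalPhysics.QuantumFieldTheory.Balaban1983to89.Beta
open B12Sec2to5 (l1 l1_nonneg)
open DyadicShell (Pt toReal supNorm mem_annulus_iff ne_zero_of_mem_annulus supNorm_eq_of_mem_sphere supNorm_eq_zero_iff natAbs_le_supNorm
  toReal_apply)
open BubbleTransfer (Leg unitVec)
open TwoPowerLegs (free freeMixedLeg supNorm_sub_le_supNorm_add supNorm_unitVec abs_latticeGreen_half_le freeMixedLeg_a free_g)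
open GhostTable (gFree mixedDiffFun fwdDiffFun cellForm freeMixedLeg_f)
open SquareTable (stK stK_eq_closedForm mixedDiffFun_sq)
open WindowIdentification (fullSum psum)
open ExpKernelCalculus (summable_exp_shift')
open Summit.QuantumFields.BalabanUV.Beta.D1BFx.SbpShellAlgebra
open Summit.QuantumFields.BalabanUV.Beta.D1BFx.SbpShellTerm
open Summit.QuantumFields.BalabanUV.Beta.D1BFx.SbpShellRemainder

namespace Summit.QuantumFields.BalabanUV.Beta.D1BFx.SbpScalarEnd

variable {μ ν : Fin 4}

/-! ## §5 The C3 END with no second-difference row -/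

section End

open OneStepResolventKernel (JetData)
open OneStepKernelFamily (TbalOf D1Drift)
open MarginalTelescoping (composedCoeff IdentityForm)
open ScalewiseVectorSeam (splitOf)
open BubbleTransfer (lattBubble)
open SquareTable (bfCoeff bfP bfQ hdeg_bf hval_bf stencilSum_bf_free)

variable {Lc : ℕ} [NeZero Lc] {κB : Type*}

/-- [folklore] The free reference integrand IS the realised table's window kernel (legs read at `k = 0`). -/
theorem stK_free_eq_lattBubble (hμν : μ ≠ ν) (N : ℝ) (L k : ℕ) (w : Pt) :
    stK μ ν N gFree w = toReal w μ * toReal w ν * lattBubble Finset.univ (bfCoeff N) (bfP hμν) (bfQ hμν) L k w := by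
  unfold SquareTable.stK
  rw [stencilSum_bf_free hμν N L k w]

/-- [folklore] The four free-leg facts of `gFree` used by `sbp_A1`: bounded, `C₂/‖·‖²`, first differences `C₃/‖·‖³`, mixed differences `C₄/‖·‖⁴`
(the UNCONDITIONAL legs `TwoPowerLegs.free.baseLeg` ∕ `free.fwdLeg` ∕ `freeMixedLeg`). -/
theorem gFree_facts (hμν : μ ≠ ν) :
    (∀ v, |gFree v| ≤ free.U) ∧ (∀ v : Pt, v ≠ 0 → |gFree v| ≤ (free.baseLeg.A + free.baseLeg.B) / (supNorm v : ℝ) ^ 2) ∧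
      (∀ v : Pt, v ≠ 0 → ∀ ρ : Fin 4, |gFree (v + unitVec ρ) - gFree v| ≤
        (∑ ρ' : Fin 4, ((free.fwdLeg ρ').A + (free.fwdLeg ρ').B)) / (supNorm v : ℝ) ^ 3) ∧
      (∀ v : Pt, v ≠ 0 → |mixedDiffFun gFree (unitVec μ) (unitVec ν) v| ≤
        ((freeMixedLeg hμν).A + (freeMixedLeg hμν).B) / (supNorm v : ℝ) ^ 4) := by
  refine ⟨fun v => free.bdd 0 0 v, fun v hv => ?_, fun v hv ρ => ?_, fun v hv => ?_⟩
  · have h : |gFree v| ≤ (free.baseLeg.A + free.baseLeg.B) / (supNorm v : ℝ) ^ 2 := free.baseLeg.abs_f_le 0 0 hv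
    exact h
  · have h : |gFree (v + unitVec ρ) - gFree v| ≤ ((free.fwdLeg ρ).A + (free.fwdLeg ρ).B) / (supNorm v : ℝ) ^ 3 :=
      (free.fwdLeg ρ).abs_f_le 0 0 hv
    refine h.trans (div_le_div_of_nonneg_right ?_ (by positivity))
    exact Finset.single_le_sum (f := fun ρ' : Fin 4 => (free.fwdLeg ρ').A + (free.fwdLeg ρ').B)
      (fun ρ' _ => add_nonneg (free.fwdLeg ρ').nonneg_A (free.fwdLeg ρ').nonneg_B) (Finset.mem_univ ρ)
  · have h : |mixedDiffFun gFree (unitVec μ) (unitVec ν) v| ≤ ((freeMixedLeg hμν).A + (freeMixedLeg hμν).B) / (supNorm v : ℝ) ^ 4 :=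
      (freeMixedLeg hμν).abs_f_le 0 0 hv
    exact h

/-- [folklore] **C3 (STRONG GRADING) WITH NO SECOND-DIFFERENCE ROW.**  `ShellRoadEnd.d1Drift_of_strongRoad_shell` with the shell rows `h2s` and `d2s` DELETED:
for ANY jet data `Js` and channel `μ ≠ ν`: bridge B1 (`hB1`), the road's target T (`hT`, convex base-point weights), and the FOUR first-order rows of the
profiles `Gf n b` — `h0` (`|Gf − gFree| ≤ D₀/n²`), `h1` (`|F_ρ(Gf − gFree)| ≤ D₁/n³`) everywhere, `d0` (`|Gf| ≤ A₀e^{−(δ/n)‖v‖}/‖v‖²`), `d1`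
(`|F_ρ Gf| ≤ A₁e^{−(δ/n)‖v‖}/‖v‖³`) off the origin — ⟹ THE WALL's LITERAL TERM `D1Drift Lc Js N μ ν`.  Proof: `sbp_A1` at every `n = Lc^m`, `b ∈ Bset n`
(n-uniform A₁-form), convexity over `b`, `hB1`/`hT`, then leaf-07's `ShellWindowInterface.oneLoopDrift_of_windowSumPow_identity` on the realised table (`hdeg_bf`, `hval_bf`). -/
theorem d1Drift_of_strongRoad_sbp (Js : ℕ → JetData 3 Lc) (hμν : μ ≠ ν) {N : ℝ} (hN : N ≠ 0) (hL : 2 ≤ Lc)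
    (c : ℕ → ℝ) {Bset : ℕ → Finset κB} {wt : ℕ → κB → ℝ} {Gf : ℕ → κB → Pt → ℝ} {D A : ℕ → ℝ}
    (hD : ∀ j, 0 ≤ D j) (hA : ∀ j, 0 ≤ A j) {δ U₁ U₂ : ℝ} (hδ : 0 < δ)
    (hwt0 : ∀ n : ℕ, 2 ≤ n → ∀ b ∈ Bset n, 0 ≤ wt n b) (hwt1 : ∀ n : ℕ, 2 ≤ n → ∑ b ∈ Bset n, wt n b = 1)
    (h0 : ∀ n : ℕ, 2 ≤ n → ∀ b ∈ Bset n, ∀ v, |Gf n b v - gFree v| ≤ D 0 / (n : ℝ) ^ 2)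
    (h1 : ∀ n : ℕ, 2 ≤ n → ∀ b ∈ Bset n, ∀ v (ρ : Fin 4),
      |(Gf n b (v + unitVec ρ) - gFree (v + unitVec ρ)) - (Gf n b v - gFree v)| ≤ D 1 / (n : ℝ) ^ 3)
    (d0 : ∀ n : ℕ, 2 ≤ n → ∀ b ∈ Bset n, ∀ v : Pt, v ≠ 0 → |Gf n b v| ≤ A 0 * Real.exp (-(δ / n) * supNorm v) / (supNorm v : ℝ) ^ 2)
    (d1 : ∀ n : ℕ, 2 ≤ n → ∀ b ∈ Bset n, ∀ v : Pt, v ≠ 0 → ∀ ρ : Fin 4,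
      |Gf n b (v + unitVec ρ) - Gf n b v| ≤ A 1 * Real.exp (-(δ / n) * supNorm v) / (supNorm v : ℝ) ^ 3)
    (hB1 : ∀ m : ℕ, 1 ≤ m → |(∑ j ∈ range m, B12Beta.secondMoment (TbalOf Lc Js j) μ ν) - c (Lc ^ m)| ≤ U₁)
    (hT : ∀ m : ℕ, 1 ≤ m → |c (Lc ^ m) - ∑ b ∈ Bset (Lc ^ m), wt (Lc ^ m) b * fullSum (stK μ ν N (Gf (Lc ^ m) b))| ≤ U₂) :
    D1Drift Lc Js N μ ν := by
  classical
  obtain ⟨hgU, hg2, hg3, hg4⟩ := gFree_facts hμν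
  set U0 := free.U
  set C2 := free.baseLeg.A + free.baseLeg.B with hC2d
  set C3 := ∑ ρ' : Fin 4, ((free.fwdLeg ρ').A + (free.fwdLeg ρ').B) with hC3d
  set C4 := (freeMixedLeg hμν).A + (freeMixedLeg hμν).B with hC4d
  have hU0 : 0 ≤ U0 := free.nonneg_U
  have hC2 : 0 ≤ C2 := add_nonneg free.baseLeg.nonneg_A free.baseLeg.nonneg_B
  have hC3 : 0 ≤ C3 := Finset.sum_nonneg fun ρ' _ => add_nonneg (free.fwdLeg ρ').nonneg_A (free.fwdLeg ρ').nonneg_B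
  have hC4 : 0 ≤ C4 := add_nonneg (freeMixedLeg hμν).nonneg_A (freeMixedLeg hμν).nonneg_B
  set A1c : ℝ := 1600 * N ^ 2 * D 1 * (4 * (U0 + C2) + D 0 + 8 * (2 * U0 + C3) + D 1) +
    1600 * N ^ 2 * (C4 * D 0 + D 1 * (16 * U0 + 9 * C3) + D 1 * D 1) +
    80 * (20 * N ^ 2 * Real.exp δ * (4 * A 0 + 8 * A 1) * (8 * A 1 + C3) + Real.exp δ * N ^ 2 * (80 * A 0 * C4 + 1280 * A 1 ^ 2)) *
      (1 + 1 / δ) with hA1c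
  -- the A₁-form at every scale, averaged over the base points
  have hpow : ∀ m : ℕ, 1 ≤ m → 2 ≤ Lc ^ m := fun m hm => hL.trans (Nat.le_self_pow (by omega) Lc)
  have havg : ∀ m : ℕ, 1 ≤ m →
      |∑ b ∈ Bset (Lc ^ m), wt (Lc ^ m) b * fullSum (stK μ ν N (Gf (Lc ^ m) b)) - ∑ w ∈ annulus 4 0 (Lc ^ m), stK μ ν N gFree w| ≤ A1c := by
    intro m hm
    have hn := hpow m hm
    set n := Lc ^ m with hndef
    set Y := ∑ w ∈ annulus 4 0 n, stK μ ν N gFree w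
    have hbnd : ∀ b ∈ Bset n, |fullSum (stK μ ν N (Gf n b)) - Y| ≤ A1c := fun b hb =>
      sbp_A1 hμν N hn (Gf n b) gFree hU0 hC2 hC3 hC4 (hD 0) (hD 1) (hA 0) (hA 1) hδ hgU hg2 hg3 hg4 (h0 n hn b hb) (h1 n hn b hb)
        (d0 n hn b hb) (d1 n hn b hb)
    have e : ∑ b ∈ Bset n, wt n b * fullSum (stK μ ν N (Gf n b)) - Y = ∑ b ∈ Bset n, wt n b * (fullSum (stK μ ν N (Gf n b)) - Y) := by
      simp only [mul_sub, Finset.sum_sub_distrib, ← Finset.sum_mul, hwt1 n hn, one_mul]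
    rw [e]
    calc |∑ b ∈ Bset n, wt n b * (fullSum (stK μ ν N (Gf n b)) - Y)| ≤ ∑ b ∈ Bset n, |wt n b * (fullSum (stK μ ν N (Gf n b)) - Y)| :=
          Finset.abs_sum_le_sum_abs _ _
      _ ≤ ∑ b ∈ Bset n, wt n b * A1c := Finset.sum_le_sum fun b hb => by
          rw [abs_mul, abs_of_nonneg (hwt0 n hn b hb)]
          exact mul_le_mul_of_nonneg_left (hbnd b hb) (hwt0 n hn b hb)
      _ = A1c := by rw [← Finset.sum_mul, hwt1 n hn, one_mul]
  -- the drift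
  set β0 : ℕ → ℝ := fun j => B12Beta.secondMoment (TbalOf Lc Js j) μ ν with hβ0
  have hid : IdentityForm (fun j _ => β0 j) (splitOf β0).β0 := fun _ _ _ => rfl
  have hcomp : ∀ m, composedCoeff (fun j _ => β0 j) m = ∑ j ∈ range m, β0 j := fun _ => rfl
  have hA₁ : ∀ m : ℕ, 1 ≤ m → |composedCoeff (fun j _ => β0 j) m -
      ∑ w ∈ annulus 4 0 ((fun n : ℕ => n) (Lc ^ m)), toReal w μ * toReal w ν * lattBubble Finset.univ (bfCoeff N) (bfP hμν) (bfQ hμν) (Lc ^ m) 0 w| ≤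
      U₁ + U₂ + A1c := by
    intro m hm
    rw [hcomp]
    have hY : ∑ w ∈ annulus 4 0 (Lc ^ m), toReal w μ * toReal w ν * lattBubble Finset.univ (bfCoeff N) (bfP hμν) (bfQ hμν) (Lc ^ m) 0 w =
        ∑ w ∈ annulus 4 0 (Lc ^ m), stK μ ν N gFree w := Finset.sum_congr rfl fun w _ => (stK_free_eq_lattBubble hμν N (Lc ^ m) 0 w).symm
    show |(∑ j ∈ range m, β0 j) - ∑ w ∈ annulus 4 0 (Lc ^ m), toReal w μ * toReal w ν *
      lattBubble Finset.univ (bfCoeff N) (bfP hμν) (bfQ hμν) (Lc ^ m) 0 w| ≤ U₁ + U₂ + A1c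
    rw [hY]
    have e : (∑ j ∈ range m, β0 j) - ∑ w ∈ annulus 4 0 (Lc ^ m), stK μ ν N gFree w =
        ((∑ j ∈ range m, β0 j) - c (Lc ^ m)) + (c (Lc ^ m) - ∑ b ∈ Bset (Lc ^ m), wt (Lc ^ m) b * fullSum (stK μ ν N (Gf (Lc ^ m) b))) +
          (∑ b ∈ Bset (Lc ^ m), wt (Lc ^ m) b * fullSum (stK μ ν N (Gf (Lc ^ m) b)) - ∑ w ∈ annulus 4 0 (Lc ^ m), stK μ ν N gFree w) := by ring
    rw [e]
    exact (abs_add_le _ _).trans (add_le_add ((abs_add_le _ _).trans (add_le_add (hB1 m hm) (hT m hm))) (havg m hm))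
  have hc : (1 : ℝ) ≤ 1 := le_rfl
  have hM : ∀ L : ℕ, 2 ≤ L → 1 ≤ (fun n : ℕ => n) L ∧ (L : ℝ) ≤ 1 * ((fun n : ℕ => n) L : ℕ) := fun L hL2 =>
    ⟨le_trans (by norm_num) hL2, by simp⟩
  have hML : ∀ L : ℕ, 2 ≤ L → (fun n : ℕ => n) L ≤ L := fun _ _ => le_rfl
  exact ⟨_, ShellWindowInterface.oneLoopDrift_of_windowSumPow_identity (splitOf β0) (hdeg_bf hμν) hμν hN (hval_bf hμν N) hL
    (μC := fun j _ => β0 j) (M := fun n : ℕ => n) hc hM hML hA₁ hid⟩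

end End

end Summit.QuantumFields.BalabanUV.Beta.D1BFx.SbpScalarEnd

end
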